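import Summits.QuantumAdvantage.QuantumAdvantage.Theorems.SosSandwichPseudoBoundedAAClassicalCornerQuadraticCostLeaf
import HarnessLib

/-!
# Crux `PseudoBoundedAA` (stmt-QuantumAdvantage-15237, route SosSandwich) — classical corner, quadratic form in EXPECTED COST (2/2):
# `16·Var[p]² ≤ E_x [Q̄(x) · maxⱼ (p(x) − p(xʲ))²]`

For `p = Σ_{k∈s} w_k·[t_k accepts]` on the cube (`w_k ≥ 0`, `Σ w_k ≤ 1`: the acceptance probability of a randomized classical query
algorithm) and every `m ≥ 0` dominating the squared flip-increments pointwise (`(p(x) − p(xʲ))² ≤ m(x)`):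

  `16 · Var[p]² ≤ E_x [Q̄(x) · m(x)]`,  `Q̄(x) = Σ_k w_k · cost_{t_k}(x)` = expected number of queries ON INPUT `x`

(`sixteen_variance_sq_le_avgCost_mul`; from `cov_le_sqrt_cost` of the sibling file by weighted Cauchy–Schwarz over the mixture).
With `m(x) = maxⱼ (p(x) − p(xʲ))²` this refines the depth form `16·Var[p]² ≤ D̄ · E_x maxⱼ (p(x) − p(xʲ))²`
(`SosSandwichPseudoBoundedAAClassicalCornerQuadratic.lean`), since `Q̄(x) ≤ D̄`; it is the `L²`/martingale counterpart of the tree's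
expected-cost OSSS law `16·Var² ≤ Q̄²·maxⱼ Infⱼ` (`ClassicalCorner…AvgCost`), with ONE factor of the query count and the maximum over
coordinates inside the expectation.  Honest label: helper; no stub, crux or summit is closed.  Sources: O'Donnell–Saks–Schramm–
Servedio FOCS 2005 Thm 3.2; H. K. Lee, ToC 6 (2010); Aaronson–Ambainis arXiv:0911.0996 Conj. 6 / Thm 8.
-/

set_option linter.dupNamespace false

noncomputable section

namespace Summit.QuantumAdvantage.QuantumAdvantage.Theorems.SosSandwich

open Finset Function
open Literature.Computability.Complexity Literature.Computability.QuantumComplexity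

namespace ClassicalCornerQuadratic

variable {N : ℕ}

/-- **Quadratic OSSS law for mixtures, expected-cost form.** If `p` is on the cube a mixture `Σ_k w_k·[t_k accepts]` of decision
trees (`w_k ≥ 0`, `Σ_k w_k ≤ 1`) and `m ≥ 0` dominates the squared flip-increments of `p` pointwise (`(p(x) − p(xʲ))² ≤ m(x)`), then

  `16 · Var[p]² ≤ E_x [Q̄(x) · m(x)]`,  `Q̄(x) = Σ_k w_k · cost_{t_k}(x)` (expected number of queries on input `x`);

with `m(x) = maxⱼ (p(x) − p(xʲ))²` this refines `sixteen_variance_sq_le_avgDepth_mul` (`Q̄(x) ≤ D̄`).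
[cite: OdonnellEtAl2005, Thm 3.2 (L¹ form)] [cite: AaronsonAmbainis2014, Conj. 6 / Thm 8] -/
theorem sixteen_variance_sq_le_avgCost_mul {ι : Type*} (s : Finset ι) (w : ι → ℝ) (hw : ∀ k ∈ s, 0 ≤ w k)
    (hw1 : ∑ k ∈ s, w k ≤ 1) (t : ι → DecisionTree N) (p : MvPolynomial (Fin N) ℝ)
    (hp : ∀ x, evalBool p x = ∑ k ∈ s, w k * (if (t k).eval x = true then (1 : ℝ) else 0))
    (m : (Fin N → Bool) → ℝ) (hm0 : ∀ x, 0 ≤ m x)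
    (hm : ∀ (j : Fin N) (x : Fin N → Bool), (evalBool p x - evalBool p (flipBit j x)) ^ 2 ≤ m x) :
    16 * boolVariance p ^ 2 ≤ (∑ x, (∑ k ∈ s, w k * ((t k).cost x : ℝ)) * m x) / (2 : ℝ) ^ N := by
  -- the update-increments of `p` at `x` are its flip-increments at `x`
  have hm' : ∀ (j : Fin N) (x : Fin N → Bool),
      (evalBool p (update x j true) - evalBool p (update x j false)) ^ 2 ≤ m x := by
    intro j x
    have h := ClassicalCorner.abs_update_sub_eq (evalBool p) j x
    have : (evalBool p (update x j true) - evalBool p (update x j false)) ^ 2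
        = (evalBool p x - evalBool p (flipBit j x)) ^ 2 := by
      rw [← sq_abs, h, sq_abs]
    rw [this]; exact hm j x
  set F : ι → (Fin N → Bool) → ℝ := fun k x => if (t k).eval x = true then (1 : ℝ) else 0 with hF
  have h2N : (0 : ℝ) < (2 : ℝ) ^ N := by positivity
  -- linearity of the covariance in the first argument
  have hPg : ∑ x, evalBool p x * evalBool p x = ∑ k ∈ s, w k * ∑ x, F k x * evalBool p x := by
    calc ∑ x, evalBool p x * evalBool p x = ∑ x, ∑ k ∈ s, w k * (F k x * evalBool p x) := by
          refine Finset.sum_congr rfl fun x _ => ?_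
          nth_rw 1 [hp x]
          rw [Finset.sum_mul]
          exact Finset.sum_congr rfl fun k _ => by simp only [hF]; ring
      _ = ∑ k ∈ s, ∑ x, w k * (F k x * evalBool p x) := Finset.sum_comm
      _ = ∑ k ∈ s, w k * ∑ x, F k x * evalBool p x :=
          Finset.sum_congr rfl fun k _ => by rw [Finset.mul_sum]
  have hPs : ∑ x, evalBool p x = ∑ k ∈ s, w k * ∑ x, F k x := by
    calc ∑ x, evalBool p x = ∑ x, ∑ k ∈ s, w k * F k x := Finset.sum_congr rfl fun x _ => by rw [hp x]
      _ = ∑ k ∈ s, ∑ x, w k * F k x := Finset.sum_comm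
      _ = ∑ k ∈ s, w k * ∑ x, F k x := Finset.sum_congr rfl fun k _ => by rw [Finset.mul_sum]
  have hlin : (2 : ℝ) ^ N * (∑ x, evalBool p x * evalBool p x) - (∑ x, evalBool p x) * (∑ x, evalBool p x)
      = ∑ k ∈ s, w k * ((2 : ℝ) ^ N * (∑ x, F k x * evalBool p x) - (∑ x, F k x) * (∑ x, evalBool p x)) := by
    have e1 : (2 : ℝ) ^ N * (∑ x, evalBool p x * evalBool p x)
        = ∑ k ∈ s, w k * ((2 : ℝ) ^ N * ∑ x, F k x * evalBool p x) := by
      rw [hPg, Finset.mul_sum]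
      exact Finset.sum_congr rfl fun k _ => by ring
    have e2 : (∑ x, evalBool p x) * (∑ x, evalBool p x)
        = ∑ k ∈ s, w k * ((∑ x, F k x) * ∑ x, evalBool p x) := by
      nth_rw 1 [hPs]
      rw [Finset.sum_mul]
      exact Finset.sum_congr rfl fun k _ => by ring
    rw [e1, e2, ← Finset.sum_sub_distrib]
    exact Finset.sum_congr rfl fun k _ => by ring
  -- each tree: `cov_le_sqrt_cost` (run with the empty partial assignment)
  set S : ι → ℝ := fun k => (2 : ℝ) ^ N * ∑ x, ((t k).cost x : ℝ) * m x with hS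
  have hS0 : ∀ k ∈ s, 0 ≤ S k := fun k _ =>
    mul_nonneg h2N.le (Finset.sum_nonneg fun x _ => mul_nonneg (Nat.cast_nonneg _) (hm0 x))
  have hterm : ∀ k ∈ s, w k * ((2 : ℝ) ^ N * (∑ x, F k x * evalBool p x) - (∑ x, F k x) * (∑ x, evalBool p x))
      ≤ w k * ((2 : ℝ) ^ N / 4 * Real.sqrt (S k)) := fun k hk =>
    mul_le_mul_of_nonneg_left (cov_le_sqrt_cost (t k) (fun _ => none) (F k) (evalBool p) m (fun x => rfl) hm') (hw k hk)
  have hsum : (2 : ℝ) ^ N * (∑ x, evalBool p x * evalBool p x) - (∑ x, evalBool p x) * (∑ x, evalBool p x)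
      ≤ (2 : ℝ) ^ N / 4 * ∑ k ∈ s, w k * Real.sqrt (S k) := by
    rw [hlin, Finset.mul_sum]
    refine Finset.sum_le_sum fun k hk => (hterm k hk).trans_eq ?_
    ring
  have hcs := sum_mul_sqrt_le s w S hw hS0
  have hvar : (2 : ℝ) ^ N * (∑ x, evalBool p x * evalBool p x) - (∑ x, evalBool p x) * (∑ x, evalBool p x)
      = (2 : ℝ) ^ N * ((2 : ℝ) ^ N * boolVariance p) :=
    BooleanCorner.sum_sq_sub_sq_sum_eq p
  set W := ∑ k ∈ s, w k with hW
  set Q := ∑ k ∈ s, w k * S k with hQ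
  have hW0 : 0 ≤ W := Finset.sum_nonneg hw
  have hQ0 : 0 ≤ Q := Finset.sum_nonneg fun k hk => mul_nonneg (hw k hk) (hS0 k hk)
  have hV0 : 0 ≤ boolVariance p := boolVariance_nonneg p
  have h := (hvar.symm.le.trans hsum).trans (mul_le_mul_of_nonneg_left hcs (by positivity))
  have hmain : 4 * ((2 : ℝ) ^ N * boolVariance p) ≤ Real.sqrt W * Real.sqrt Q := by
    have h' : (2 : ℝ) ^ N * (4 * ((2 : ℝ) ^ N * boolVariance p)) ≤ (2 : ℝ) ^ N * (Real.sqrt W * Real.sqrt Q) :=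
      calc (2 : ℝ) ^ N * (4 * ((2 : ℝ) ^ N * boolVariance p)) = 4 * ((2 : ℝ) ^ N * ((2 : ℝ) ^ N * boolVariance p)) := by
            ring
        _ ≤ 4 * ((2 : ℝ) ^ N / 4 * (Real.sqrt W * Real.sqrt Q)) := mul_le_mul_of_nonneg_left h (by norm_num)
        _ = (2 : ℝ) ^ N * (Real.sqrt W * Real.sqrt Q) := by ring
    exact le_of_mul_le_mul_left h' h2N
  have hsq : (4 * ((2 : ℝ) ^ N * boolVariance p)) ^ 2 ≤ W * Q := by
    have h1 := pow_le_pow_left₀ (by positivity) hmain 2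
    have hR : (Real.sqrt W * Real.sqrt Q) ^ 2 = W * Q := by
      rw [mul_pow, Real.sq_sqrt hW0, Real.sq_sqrt hQ0]
    rwa [hR] at h1
  -- `Q = 2^N · Σₓ Q̄(x) m(x)` and `W ≤ 1`
  have hQ' : Q = (2 : ℝ) ^ N * ∑ x, (∑ k ∈ s, w k * ((t k).cost x : ℝ)) * m x := by
    rw [hQ]
    simp only [hS, Finset.mul_sum, Finset.sum_mul]
    rw [Finset.sum_comm]
    exact Finset.sum_congr rfl fun x _ => Finset.sum_congr rfl fun k _ => by ring
  set Z := ∑ x, (∑ k ∈ s, w k * ((t k).cost x : ℝ)) * m x with hZ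
  have hZ0 : 0 ≤ Z := Finset.sum_nonneg fun x _ =>
    mul_nonneg (Finset.sum_nonneg fun k hk => mul_nonneg (hw k hk) (Nat.cast_nonneg _)) (hm0 x)
  have hWQ : W * Q ≤ Q := by
    have := mul_le_mul_of_nonneg_right hw1 hQ0
    linarith
  have hfin : (16 * boolVariance p ^ 2 * (2 : ℝ) ^ N) * (2 : ℝ) ^ N ≤ Z * (2 : ℝ) ^ N :=
    calc (16 * boolVariance p ^ 2 * (2 : ℝ) ^ N) * (2 : ℝ) ^ N = (4 * ((2 : ℝ) ^ N * boolVariance p)) ^ 2 := by ring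
      _ ≤ W * Q := hsq
      _ ≤ Q := hWQ
      _ = Z * (2 : ℝ) ^ N := by rw [hQ']; ring
  have hfin' := le_of_mul_le_mul_right hfin h2N
  rw [le_div_iff₀ h2N]
  exact hfin'

end ClassicalCornerQuadratic

end Summit.QuantumAdvantage.QuantumAdvantage.Theorems.SosSandwich
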